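import Summits.Ventures.LatticeQCDFlow.Exactness.IMHCoupledUnbiasedEstimatorMSE
import Summits.Ventures.LatticeQCDFlow.Exactness.IMHAnyStartMSE
import HarnessLib

/-!
# The time-averaged coupled estimator: averaging `L` lagged coupled estimators keeps the bias at `r^{k+N}(c − a)` (zero at
# `N = ∞`) and has mean-square error at most the burned-in window average's `MSE_{μ₀}(L; k)` plus `(1 − A)^k (c − a)² W(2W + 1)`

HONEST FRAMING: exact (Metropolis-corrected) sampling algorithms for lattice gauge theory;
figures of merit are autocorrelation/cost numbers at stated couplings and volumes; no
continuum-physics claim.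

Venture `LatticeQCDFlow` (cell pub-lqcd), topic `Exactness`; FANOUT row 30 (lean-1, GEN-37).  NEW WORK of the cell,
general state space; sequel to `Exactness/IMHCoupledUnbiasedEstimator{Variance,MSE}` (this generation).  Setting as there
(`K = indepMH q w`, `w` measurable — a `Fact` —, positive, normalised, maximal at `x₀`, `W = w(x₀) = 1/A`, `r = 1 − A`; CRN pair
kernel `K̂`, pair path law `P̂_{μ̂₀}`, `μ₂ = μ̂₀∘snd⁻¹`; `a ≤ f ≤ c` measurable, `π f`, `Var_π f`, `D = max(π f − a, c − π f)`;
corrections `D_n = f(X′_n) − f(Y_n)`).  The practitioner's estimator averages the lagged coupled estimators over a window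
(printed counterpart, named only: the «time-averaged» unbiased estimator `H_{k:m}` of Jacob–O'Leary–Atchadé):
`H̄ = (1/L)·Σ_{l<L} (f(Y_{k+l}) + Σ_{n<N} D_{k+l+n}) = A_{L,k}(Y) + (1/L)·Σ_{l<L} Σ_{n<N} D_{k+l+n}`.

* §0 bookkeeping (**`sq_rangeAvg_le_rangeAvg_sq`**): `((1/L)Σ_{l<L} t_l)² ≤ (1/L)Σ_{l<L} t_l²`.
* §1 **`crnLagAvg_integral_eq`** — under the lag condition `μ̂₀∘fst⁻¹ = μ₂K`: `E H̄ = (1/L)·Σ_{l<L} (μ₂K^{k+l+N}) f` EXACTLY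
  (the window average of the plain run, read `N` updates later); **`crnLagAvg_bias_abs_le`** — `|E H̄ − π f| ≤ r^{k+N}·(c − a)`.
* §2 **`crnLagAvg_sq_le`** — FROM EVERY INITIAL COUPLING (no lag condition):
  `E(H̄ − π f)² ≤ MSE_{μ₂}(L; k) + r^k·(c − a)²·W(2W + 1)`, where `MSE_{μ₂}(L; k) = E_{μ₂}[(A_{L,k} − π f)²]` is the mean-square
  error of the burned-in window average of ONE run (the second coordinate IS a run, `IMHCommonRandomNumbersPath`); the
  correction's square is `≤ (1/L)Σ_l E(Σ_n|D_{k+l+n}|)² ≤ r^k(c − a)²W(2W − 1)` (Variance file) and the cross term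
  `≤ 2(c − a)·(1/L)Σ_l Σ_n E|D_{k+l+n}| ≤ 2r^k(c − a)²W`;
  **`crnLagAvg_sq_le_explicit`** — with GEN-35's any-start certificate `MSE_{μ₂}(L; k) ≤ (2W − 1)Var_π f/L + r^k D²`:
  `E(H̄ − π f)² ≤ (2W − 1)·Var_π f/L + r^k·(D² + (c − a)²·W(2W + 1))` (every starting configuration `x` included:
  `μ̂₀ = (δ_x K) ⊗ δ_x`).
Reading (gauge files): the time-averaged coupled estimator of an exact gauge sampler has the error bar of the burned-in
average, `(2W − 1)Var_π f/L`, plus a start-up term `(1 − A)^k × const` — and NO bias floor as `N → ∞` (bias `≤ (1 − A)^{k+N}(c − a)`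
at truncation `N`): averaging independent replicas of it converges to `π f`, not to `π f +` burn-in bias.
NOT CLAIMED: the exact variance; that the coupled average beats the plain one at equal cost; the `N = ∞` statement as a single
integral (term by term it is GEN-36's `crnLag_unbiased`); anything for unbounded `f`.  No `sorry`, no new definitions, nothing
cited as a fact.
-/

noncomputable section

namespace Summit.Ventures.LatticeQCDFlow.Exactness

open MeasureTheory ProbabilityTheory Function Finset
open scoped ENNReal unitInterval
open Summit.Ventures.LatticeQCDFlow.Scoring

variable {Ω : Type*} [MeasurableSpace Ω] {q : Measure Ω} [IsProbabilityMeasure q] {w : Ω → ℝ}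

/-! ## §0 Bookkeeping -/

omit [MeasurableSpace Ω] in
/-- `((1/L)Σ_{l<L} t_l)² ≤ (1/L)Σ_{l<L} t_l²` (Cauchy–Schwarz; trivially true for `L = 0`). [ours, bookkeeping] -/
theorem sq_rangeAvg_le_rangeAvg_sq (t : ℕ → ℝ) (L : ℕ) :
    ((∑ l ∈ range L, t l) / L) ^ 2 ≤ (∑ l ∈ range L, t l ^ 2) / L := by
  rcases Nat.eq_zero_or_pos L with hL | hL
  · subst hL; simp
  have hLpos : (0 : ℝ) < L := by exact_mod_cast hL
  have h := sq_sum_le_card_mul_sum_sq (s := range L) (f := t)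
  rw [card_range] at h
  rw [div_pow, div_le_div_iff₀ (by positivity) hLpos]
  nlinarith [h, hLpos]

/-! ## §1 The mean of the time-averaged coupled estimator -/

/-- **`E H̄ = (1/L)·Σ_{l<L} (μ₂K^{k+l+N}) f`** under the lag condition `μ̂₀∘fst⁻¹ = μ₂K` — the mean of the burned-in window
average read `N` updates later, exactly. [ours] -/
theorem crnLagAvg_integral_eq [Fact (Measurable w)] (hw0 : ∀ y, 0 < w y) (Khat : Kernel (Ω × Ω) (Ω × Ω))
    [IsMarkovKernel Khat]
    (hK : ∀ z : Ω × Ω, Khat z = (q.prod (volume : Measure unitInterval)).map (fun p : Ω × unitInterval =>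
      ((if (p.2 : ℝ) * w z.1 ≤ w p.1 then p.1 else z.1), (if (p.2 : ℝ) * w z.2 ≤ w p.1 then p.1 else z.2))))
    (μ₀ : Measure (Ω × Ω)) [IsProbabilityMeasure μ₀]
    (hlag : μ₀.map Prod.fst = (μ₀.map Prod.snd).bind (indepMH q w)) {f : Ω → ℝ} (hf : Measurable f) {C : ℝ}
    (hC : ∀ x, |f x| ≤ C) (k N L : ℕ) :
    ∫ z, (∑ l ∈ Finset.range L, (f ((z (k + l)).2) +
        ∑ n ∈ Finset.range N, (f ((z (k + l + n)).1) - f ((z (k + l + n)).2)))) / L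
        ∂(Kernel.trajMeasure (X := fun _ : ℕ => Ω × Ω) μ₀
          (fun n : ℕ => Khat.comap (fun h : (i : ↥(Finset.Iic n)) → Ω × Ω => h ⟨n, Finset.mem_Iic.2 le_rfl⟩)
            (measurable_pi_apply _))) =
      (∑ l ∈ Finset.range L, ∫ y, f y ∂((fun m : Measure Ω => m.bind (indepMH q w))^[k + l + N] (μ₀.map Prod.snd))) / L := by
  set P := Kernel.trajMeasure (X := fun _ : ℕ => Ω × Ω) μ₀
        (fun n : ℕ => Khat.comap (fun h : (i : ↥(Finset.Iic n)) → Ω × Ω => h ⟨n, Finset.mem_Iic.2 le_rfl⟩)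
          (measurable_pi_apply _)) with hP
  have hYi : ∀ j, Integrable (fun z : ℕ → Ω × Ω => f ((z j).2)) P := fun j =>
    integrable_of_bounded P (hf.comp (measurable_snd.comp (measurable_pi_apply j))) (fun z => hC _)
  have hDi : ∀ n, Integrable (fun z : ℕ → Ω × Ω => f ((z n).1) - f ((z n).2)) P := fun n =>
    integrable_of_bounded P ((hf.comp (measurable_fst.comp (measurable_pi_apply n))).sub
      (hf.comp (measurable_snd.comp (measurable_pi_apply n)))) (fun z => (abs_sub _ _).trans (add_le_add (hC _) (hC _)))
  have hterm : ∀ l, Integrable (fun z : ℕ → Ω × Ω => f ((z (k + l)).2) +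
      ∑ n ∈ range N, (f ((z (k + l + n)).1) - f ((z (k + l + n)).2))) P := fun l =>
    (hYi (k + l)).add (integrable_finsetSum _ fun n _ => hDi (k + l + n))
  rw [integral_div, integral_finsetSum _ fun l _ => hterm l]
  exact congrArg (· / (L : ℝ)) (sum_congr rfl fun l _ => crnLag_truncated_integral_eq hw0 Khat hK μ₀ hlag hf hC (k + l) N)

/-- **`|E H̄ − π f| ≤ r^{k+N}·(c − a)`** for `a ≤ f ≤ c`, `w` maximal at `x₀` (`r = 1 − 1/w(x₀)`), `L ≥ 1`, under the lag
condition: the time-averaged coupled estimator truncated at `N` corrections carries the burn-in bias of time `k + N`. [ours] -/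
theorem crnLagAvg_bias_abs_le [Fact (Measurable w)] (hw0 : ∀ y, 0 < w y) {x₀ : Ω} (hmax : ∀ y, w y ≤ w x₀)
    [IsProbabilityMeasure (q.withDensity fun y => ENNReal.ofReal (w y))]
    (Khat : Kernel (Ω × Ω) (Ω × Ω)) [IsMarkovKernel Khat]
    (hK : ∀ z : Ω × Ω, Khat z = (q.prod (volume : Measure unitInterval)).map (fun p : Ω × unitInterval =>
      ((if (p.2 : ℝ) * w z.1 ≤ w p.1 then p.1 else z.1), (if (p.2 : ℝ) * w z.2 ≤ w p.1 then p.1 else z.2))))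
    (μ₀ : Measure (Ω × Ω)) [IsProbabilityMeasure μ₀]
    (hlag : μ₀.map Prod.fst = (μ₀.map Prod.snd).bind (indepMH q w)) {f : Ω → ℝ} (hf : Measurable f) {a c : ℝ}
    (ha : ∀ x, a ≤ f x) (hc : ∀ x, f x ≤ c) (k N : ℕ) {L : ℕ} (hL : L ≠ 0) :
    |∫ z, (∑ l ∈ Finset.range L, (f ((z (k + l)).2) +
        ∑ n ∈ Finset.range N, (f ((z (k + l + n)).1) - f ((z (k + l + n)).2)))) / L
        ∂(Kernel.trajMeasure (X := fun _ : ℕ => Ω × Ω) μ₀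
          (fun n : ℕ => Khat.comap (fun h : (i : ↥(Finset.Iic n)) → Ω × Ω => h ⟨n, Finset.mem_Iic.2 le_rfl⟩)
            (measurable_pi_apply _))) - ∫ x, f x ∂(q.withDensity fun y => ENNReal.ofReal (w y))| ≤
      (1 - (w x₀)⁻¹) ^ (k + N) * (c - a) := by
  haveI : IsProbabilityMeasure (μ₀.map Prod.snd) := Measure.isProbabilityMeasure_map measurable_snd.aemeasurable
  have hC : ∀ x, |f x| ≤ max |a| |c| := fun x => abs_le_max_abs_abs (ha x) (hc x)
  rw [crnLagAvg_integral_eq hw0 Khat hK μ₀ hlag hf hC k N L]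
  set π : Measure Ω := q.withDensity fun y => ENNReal.ofReal (w y) with hπ
  set u : ℕ → ℝ := fun M => ∫ y, f y ∂((fun m : Measure Ω => m.bind (indepMH q w))^[M] (μ₀.map Prod.snd)) with hu
  have hLpos : (0 : ℝ) < L := by exact_mod_cast Nat.pos_of_ne_zero hL
  have hW : 1 ≤ w x₀ := one_le_of_mode (q := q) hmax
  have hr0 : 0 ≤ 1 - (w x₀)⁻¹ := sub_nonneg.2 (inv_le_one_of_one_le₀ hW)
  have hr1 : 1 - (w x₀)⁻¹ ≤ 1 := sub_le_self _ (inv_nonneg.mpr (hw0 x₀).le)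
  have hca : 0 ≤ c - a := by have h1 := ha x₀; have h2 := hc x₀; linarith
  have heach : ∀ l, |u (k + l + N) - ∫ x, f x ∂π| ≤ (1 - (w x₀)⁻¹) ^ (k + N) * (c - a) := fun l => by
    haveI := isProbabilityMeasure_iterate_bind (κ := indepMH q w) (μ₀.map Prod.snd) (k + l + N)
    refine (integral_iterate_bind_indepMH_abs_le (q := q) Fact.out hw0 hmax (k + l + N) (μ₀.map Prod.snd) hf ha hc).trans ?_
    refine mul_le_mul_of_nonneg_right ?_ hca
    rw [show k + l + N = (k + N) + l by ring, pow_add]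
    exact mul_le_of_le_one_right (pow_nonneg hr0 _) (pow_le_one₀ hr0 hr1)
  have hrw : (∑ l ∈ range L, u (k + l + N)) / L - ∫ x, f x ∂π = (∑ l ∈ range L, (u (k + l + N) - ∫ x, f x ∂π)) / L := by
    rw [sum_sub_distrib, sum_const, card_range, nsmul_eq_mul]
    field_simp
  rw [hrw, abs_div, abs_of_pos hLpos, div_le_iff₀ hLpos]
  calc |∑ l ∈ range L, (u (k + l + N) - ∫ x, f x ∂π)| ≤ ∑ l ∈ range L, |u (k + l + N) - ∫ x, f x ∂π| :=
        abs_sum_le_sum_abs _ _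
    _ ≤ ∑ l ∈ range L, (1 - (w x₀)⁻¹) ^ (k + N) * (c - a) := sum_le_sum fun l _ => heach l
    _ = (1 - (w x₀)⁻¹) ^ (k + N) * (c - a) * L := by rw [sum_const, card_range, nsmul_eq_mul]; ring

/-! ## §2 The mean-square error of the time-averaged coupled estimator -/

/-- **THE MEAN-SQUARE ERROR OF THE TIME-AVERAGED COUPLED ESTIMATOR**: `w` measurable (a `Fact`), positive, normalised, maximal
at `x₀` (`W = w(x₀)`, `r = 1 − 1/W`); `K̂` a CRN pair kernel; `a ≤ f ≤ c` measurable; ANY initial coupling `μ̂₀` (`μ₂ = μ̂₀∘snd⁻¹`);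
`L ≥ 1`, every `k`, `N`:
`E[(H̄ − π f)²] ≤ E_{μ₂}[(A_{L,k} − π f)²] + r^k·(c − a)²·W(2W + 1)` — the burned-in window average's error plus a geometrically
small price for removing its bias. [ours] -/
theorem crnLagAvg_sq_le [Fact (Measurable w)] (hw0 : ∀ y, 0 < w y) {x₀ : Ω} (hmax : ∀ y, w y ≤ w x₀)
    [IsProbabilityMeasure (q.withDensity fun y => ENNReal.ofReal (w y))]
    (Khat : Kernel (Ω × Ω) (Ω × Ω)) [IsMarkovKernel Khat]
    (hK : ∀ z : Ω × Ω, Khat z = (q.prod (volume : Measure unitInterval)).map (fun p : Ω × unitInterval =>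
      ((if (p.2 : ℝ) * w z.1 ≤ w p.1 then p.1 else z.1), (if (p.2 : ℝ) * w z.2 ≤ w p.1 then p.1 else z.2))))
    (μ₀ : Measure (Ω × Ω)) [IsProbabilityMeasure μ₀] {f : Ω → ℝ} (hf : Measurable f) {a c : ℝ}
    (ha : ∀ x, a ≤ f x) (hc : ∀ x, f x ≤ c) (k N : ℕ) {L : ℕ} (hL : L ≠ 0) :
    ∫ z, ((∑ l ∈ Finset.range L, (f ((z (k + l)).2) +
          ∑ n ∈ Finset.range N, (f ((z (k + l + n)).1) - f ((z (k + l + n)).2)))) / L -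
          ∫ x, f x ∂(q.withDensity fun y => ENNReal.ofReal (w y))) ^ 2
        ∂(Kernel.trajMeasure (X := fun _ : ℕ => Ω × Ω) μ₀
          (fun n : ℕ => Khat.comap (fun h : (i : ↥(Finset.Iic n)) → Ω × Ω => h ⟨n, Finset.mem_Iic.2 le_rfl⟩)
            (measurable_pi_apply _))) ≤
      ∫ x, ((∑ l ∈ Finset.range L, f (x (k + l))) / L - ∫ x, f x ∂(q.withDensity fun y => ENNReal.ofReal (w y))) ^ 2
          ∂(Kernel.trajMeasure (X := fun _ : ℕ => Ω) (μ₀.map Prod.snd)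
            (fun n : ℕ => (indepMH q w).comap (fun h : (i : ↥(Finset.Iic n)) → Ω => h ⟨n, Finset.mem_Iic.2 le_rfl⟩)
              (measurable_pi_apply _))) +
        (1 - (w x₀)⁻¹) ^ k * (c - a) ^ 2 * (w x₀ * (2 * w x₀ + 1)) := by
  haveI : IsProbabilityMeasure (μ₀.map Prod.snd) := Measure.isProbabilityMeasure_map measurable_snd.aemeasurable
  set P := Kernel.trajMeasure (X := fun _ : ℕ => Ω × Ω) μ₀
        (fun n : ℕ => Khat.comap (fun h : (i : ↥(Finset.Iic n)) → Ω × Ω => h ⟨n, Finset.mem_Iic.2 le_rfl⟩)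
          (measurable_pi_apply _)) with hP
  set π : Measure Ω := q.withDensity fun y => ENNReal.ofReal (w y) with hπ
  set m : ℝ := ∫ x, f x ∂π with hm
  have hLpos : (0 : ℝ) < L := by exact_mod_cast Nat.pos_of_ne_zero hL
  have hC : ∀ x, |f x| ≤ max |a| |c| := fun x => abs_le_max_abs_abs (ha x) (hc x)
  have hfi : Integrable f π := integrable_of_bounded π hf hC
  have hma : a ≤ m := by
    have := integral_mono (integrable_const a) hfi ha; rwa [integral_const, probReal_univ, one_smul] at this
  have hmc : m ≤ c := by
    have := integral_mono hfi (integrable_const c) hc; rwa [integral_const, probReal_univ, one_smul] at this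
  have hca : 0 ≤ c - a := by linarith
  have hW : 1 ≤ w x₀ := one_le_of_mode (q := q) hmax
  have hWpos : 0 < w x₀ := hw0 x₀
  have hr0 : 0 ≤ 1 - (w x₀)⁻¹ := sub_nonneg.2 (inv_le_one_of_one_le₀ hW)
  have hr1 : 1 - (w x₀)⁻¹ < 1 := sub_lt_self _ (inv_pos.mpr hWpos)
  -- the path functionals: `Ā = A_{L,k}(Y) − m`, `T_l = Σ_n |D_{k+l+n}|`, `T̄ = (Σ_l T_l)/L`
  have hDm' : ∀ n, Measurable (fun z : ℕ → Ω × Ω => f ((z n).1) - f ((z n).2)) := fun n =>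
    (hf.comp (measurable_fst.comp (measurable_pi_apply n))).sub (hf.comp (measurable_snd.comp (measurable_pi_apply n)))
  have hDb : ∀ n (z : ℕ → Ω × Ω), |f ((z n).1) - f ((z n).2)| ≤ c - a := fun n z => by
    have h1 := ha ((z n).1); have h2 := hc ((z n).1); have h3 := ha ((z n).2); have h4 := hc ((z n).2)
    exact abs_le.2 ⟨by linarith, by linarith⟩
  have hAm : Measurable (fun z : ℕ → Ω × Ω => (∑ l ∈ range L, f ((z (k + l)).2)) / L - m) :=
    ((Finset.measurable_sum _ fun l _ => hf.comp (measurable_snd.comp (measurable_pi_apply (k + l)))).div_const _).sub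
      measurable_const
  have hAb : ∀ z : ℕ → Ω × Ω, |(∑ l ∈ range L, f ((z (k + l)).2)) / L - m| ≤ c - a := fun z => by
    obtain ⟨h1, h2⟩ := timeAverage_mem_Icc (f := f) ha hc hL (fun n => (z n).2) k
    exact abs_le.2 ⟨by linarith, by linarith⟩
  have hTm : ∀ l, Measurable (fun z : ℕ → Ω × Ω => ∑ n ∈ range N, |f ((z (k + l + n)).1) - f ((z (k + l + n)).2)|) :=
    fun l => Finset.measurable_sum _ fun n _ => (hDm' (k + l + n)).abs
  have hTnn : ∀ l (z : ℕ → Ω × Ω), 0 ≤ ∑ n ∈ range N, |f ((z (k + l + n)).1) - f ((z (k + l + n)).2)| :=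
    fun l z => sum_nonneg fun n _ => abs_nonneg _
  have hTb : ∀ l (z : ℕ → Ω × Ω), ∑ n ∈ range N, |f ((z (k + l + n)).1) - f ((z (k + l + n)).2)| ≤ N * (c - a) :=
    fun l z => (sum_le_sum fun n _ => hDb (k + l + n) z).trans_eq (by rw [sum_const, card_range, nsmul_eq_mul])
  have hTbarm : Measurable (fun z : ℕ → Ω × Ω =>
      (∑ l ∈ range L, ∑ n ∈ range N, |f ((z (k + l + n)).1) - f ((z (k + l + n)).2)|) / L) :=
    (Finset.measurable_sum _ fun l _ => hTm l).div_const _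
  have hTbarnn : ∀ z : ℕ → Ω × Ω,
      0 ≤ (∑ l ∈ range L, ∑ n ∈ range N, |f ((z (k + l + n)).1) - f ((z (k + l + n)).2)|) / L := fun z =>
    div_nonneg (sum_nonneg fun l _ => hTnn l z) hLpos.le
  have hTbarb : ∀ z : ℕ → Ω × Ω,
      (∑ l ∈ range L, ∑ n ∈ range N, |f ((z (k + l + n)).1) - f ((z (k + l + n)).2)|) / L ≤ N * (c - a) := fun z => by
    rw [div_le_iff₀ hLpos]
    calc ∑ l ∈ range L, ∑ n ∈ range N, |f ((z (k + l + n)).1) - f ((z (k + l + n)).2)|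
        ≤ ∑ l ∈ range L, (N : ℝ) * (c - a) := sum_le_sum fun l _ => hTb l z
      _ = N * (c - a) * L := by rw [sum_const, card_range, nsmul_eq_mul]; ring
  -- `|correction| ≤ T̄`
  have hCT : ∀ z : ℕ → Ω × Ω,
      |(∑ l ∈ range L, ∑ n ∈ range N, (f ((z (k + l + n)).1) - f ((z (k + l + n)).2))) / L| ≤
        (∑ l ∈ range L, ∑ n ∈ range N, |f ((z (k + l + n)).1) - f ((z (k + l + n)).2)|) / L := fun z => by
    rw [abs_div, abs_of_pos hLpos]
    exact div_le_div_of_nonneg_right ((abs_sum_le_sum_abs _ _).trans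
      (sum_le_sum fun l _ => abs_sum_le_sum_abs _ _)) hLpos.le
  -- the estimator minus `m` is `Ā + correction`
  have hsplit : ∀ z : ℕ → Ω × Ω,
      (∑ l ∈ range L, (f ((z (k + l)).2) + ∑ n ∈ range N, (f ((z (k + l + n)).1) - f ((z (k + l + n)).2)))) / L - m =
        ((∑ l ∈ range L, f ((z (k + l)).2)) / L - m) +
          (∑ l ∈ range L, ∑ n ∈ range N, (f ((z (k + l + n)).1) - f ((z (k + l + n)).2))) / L := fun z => by
    rw [sum_add_distrib, add_div]; ring
  -- pointwise: `(Ā + C)² ≤ Ā² + 2|Ā|·T̄ + T̄²`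
  have hpt : ∀ z : ℕ → Ω × Ω,
      ((∑ l ∈ range L, (f ((z (k + l)).2) +
          ∑ n ∈ range N, (f ((z (k + l + n)).1) - f ((z (k + l + n)).2)))) / L - m) ^ 2 ≤
        ((∑ l ∈ range L, f ((z (k + l)).2)) / L - m) ^ 2 +
          2 * (|(∑ l ∈ range L, f ((z (k + l)).2)) / L - m| *
            ((∑ l ∈ range L, ∑ n ∈ range N, |f ((z (k + l + n)).1) - f ((z (k + l + n)).2)|) / L)) +
          ((∑ l ∈ range L, ∑ n ∈ range N, |f ((z (k + l + n)).1) - f ((z (k + l + n)).2)|) / L) ^ 2 := fun z => by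
    rw [hsplit z]
    have h1 : ((∑ l ∈ range L, f ((z (k + l)).2)) / L - m) *
        ((∑ l ∈ range L, ∑ n ∈ range N, (f ((z (k + l + n)).1) - f ((z (k + l + n)).2))) / L) ≤
        |(∑ l ∈ range L, f ((z (k + l)).2)) / L - m| *
          ((∑ l ∈ range L, ∑ n ∈ range N, |f ((z (k + l + n)).1) - f ((z (k + l + n)).2)|) / L) := by
      refine (le_abs_self _).trans ?_
      rw [abs_mul]
      exact mul_le_mul_of_nonneg_left (hCT z) (abs_nonneg _)
    have h2 : ((∑ l ∈ range L, ∑ n ∈ range N, (f ((z (k + l + n)).1) - f ((z (k + l + n)).2))) / L) ^ 2 ≤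
        ((∑ l ∈ range L, ∑ n ∈ range N, |f ((z (k + l + n)).1) - f ((z (k + l + n)).2)|) / L) ^ 2 := by
      rw [← sq_abs]; exact pow_le_pow_left₀ (abs_nonneg _) (hCT z) 2
    nlinarith [h1, h2]
  -- integrability of the pieces (all bounded and measurable)
  have hA2i : Integrable (fun z : ℕ → Ω × Ω => ((∑ l ∈ range L, f ((z (k + l)).2)) / L - m) ^ 2) P :=
    integrable_of_bounded P (hAm.pow_const 2) (C := (c - a) ^ 2) (fun z => by
      rw [abs_pow]; exact pow_le_pow_left₀ (abs_nonneg _) (hAb z) 2)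
  have hATi : Integrable (fun z : ℕ → Ω × Ω => |(∑ l ∈ range L, f ((z (k + l)).2)) / L - m| *
      ((∑ l ∈ range L, ∑ n ∈ range N, |f ((z (k + l + n)).1) - f ((z (k + l + n)).2)|) / L)) P :=
    integrable_of_bounded P (hAm.abs.mul hTbarm) (C := (c - a) * (N * (c - a))) (fun z => by
      rw [abs_mul, abs_abs, abs_of_nonneg (hTbarnn z)]
      exact mul_le_mul (hAb z) (hTbarb z) (hTbarnn z) hca)
  have hT2i : Integrable (fun z : ℕ → Ω × Ω =>
      ((∑ l ∈ range L, ∑ n ∈ range N, |f ((z (k + l + n)).1) - f ((z (k + l + n)).2)|) / L) ^ 2) P :=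
    integrable_of_bounded P (hTbarm.pow_const 2) (C := (N * (c - a)) ^ 2) (fun z => by
      rw [abs_pow, abs_of_nonneg (hTbarnn z)]; exact pow_le_pow_left₀ (hTbarnn z) (hTbarb z) 2)
  have hLm : Measurable (fun z : ℕ → Ω × Ω => ((∑ l ∈ range L, (f ((z (k + l)).2) +
      ∑ n ∈ range N, (f ((z (k + l + n)).1) - f ((z (k + l + n)).2)))) / L - m) ^ 2) :=
    (((Finset.measurable_sum _ fun l _ => (hf.comp (measurable_snd.comp (measurable_pi_apply (k + l)))).add
      (Finset.measurable_sum _ fun n _ => hDm' (k + l + n))).div_const _).sub measurable_const).pow_const 2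
  have hLi : Integrable (fun z : ℕ → Ω × Ω => ((∑ l ∈ range L, (f ((z (k + l)).2) +
      ∑ n ∈ range N, (f ((z (k + l + n)).1) - f ((z (k + l + n)).2)))) / L - m) ^ 2) P :=
    integrable_of_bounded P hLm (C := ((c - a) + N * (c - a)) ^ 2) (fun z => by
      rw [abs_pow, hsplit z]
      refine pow_le_pow_left₀ (abs_nonneg _) ?_ 2
      exact (abs_add_le _ _).trans (add_le_add (hAb z) ((hCT z).trans (hTbarb z))))
  have h12 : Integrable (fun z : ℕ → Ω × Ω => ((∑ l ∈ range L, f ((z (k + l)).2)) / L - m) ^ 2 +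
      2 * (|(∑ l ∈ range L, f ((z (k + l)).2)) / L - m| *
        ((∑ l ∈ range L, ∑ n ∈ range N, |f ((z (k + l + n)).1) - f ((z (k + l + n)).2)|) / L))) P :=
    hA2i.add (hATi.const_mul 2)
  have h123 : Integrable (fun z : ℕ → Ω × Ω => ((∑ l ∈ range L, f ((z (k + l)).2)) / L - m) ^ 2 +
      2 * (|(∑ l ∈ range L, f ((z (k + l)).2)) / L - m| *
        ((∑ l ∈ range L, ∑ n ∈ range N, |f ((z (k + l + n)).1) - f ((z (k + l + n)).2)|) / L)) +
      ((∑ l ∈ range L, ∑ n ∈ range N, |f ((z (k + l + n)).1) - f ((z (k + l + n)).2)|) / L) ^ 2) P :=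
    h12.add hT2i
  -- (E1) the window term is the single-run window error (the second coordinate IS a run)
  have hgm : Measurable (fun x : ℕ → Ω => ((∑ l ∈ range L, f (x (k + l))) / L - m) ^ 2) :=
    (((Finset.measurable_sum _ fun l _ => hf.comp (measurable_pi_apply (k + l))).div_const _).sub
      measurable_const).pow_const 2
  have hφ : Measurable (fun (z : ℕ → Ω × Ω) (n : ℕ) => (z n).2) :=
    measurable_pi_lambda _ fun n => measurable_snd.comp (measurable_pi_apply n)
  have hE1 : ∫ z, ((∑ l ∈ range L, f ((z (k + l)).2)) / L - m) ^ 2 ∂P =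
      ∫ x, ((∑ l ∈ range L, f (x (k + l))) / L - m) ^ 2
        ∂(Kernel.trajMeasure (X := fun _ : ℕ => Ω) (μ₀.map Prod.snd)
          (fun n : ℕ => (indepMH q w).comap (fun h : (i : ↥(Finset.Iic n)) → Ω => h ⟨n, Finset.mem_Iic.2 le_rfl⟩)
            (measurable_pi_apply _))) := by
    rw [← crn_chain_map_snd hw0 Khat hK μ₀, integral_map hφ.aemeasurable hgm.aestronglyMeasurable]
  -- (E2) the cross term
  have hDi : ∀ n, Integrable (fun z : ℕ → Ω × Ω => |f ((z n).1) - f ((z n).2)|) P := fun n =>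
    integrable_of_bounded P (hDm' n).abs (fun z => by rw [abs_abs]; exact hDb n z)
  have hgeomN : ∀ j, ∑ n ∈ range N, (1 - (w x₀)⁻¹) ^ (j + n) * (c - a) ≤ (1 - (w x₀)⁻¹) ^ j * (c - a) * w x₀ := fun j => by
    have hs := sum_le_hasSum (range N) (fun n _ => pow_nonneg hr0 n) (hasSum_geometric_of_lt_one hr0 hr1)
    rw [sub_sub_cancel, inv_inv] at hs
    calc ∑ n ∈ range N, (1 - (w x₀)⁻¹) ^ (j + n) * (c - a)
        = (1 - (w x₀)⁻¹) ^ j * (c - a) * ∑ n ∈ range N, (1 - (w x₀)⁻¹) ^ n := by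
          rw [mul_sum]; refine sum_congr rfl fun n _ => ?_; rw [pow_add]; ring
      _ ≤ (1 - (w x₀)⁻¹) ^ j * (c - a) * w x₀ := mul_le_mul_of_nonneg_left hs (by positivity)
  have hpowle : ∀ l, (1 - (w x₀)⁻¹) ^ (k + l) ≤ (1 - (w x₀)⁻¹) ^ k := fun l => by
    rw [pow_add]; exact mul_le_of_le_one_right (pow_nonneg hr0 _) (pow_le_one₀ hr0 hr1.le)
  have hE2 : ∫ z, |(∑ l ∈ range L, f ((z (k + l)).2)) / L - m| *
      ((∑ l ∈ range L, ∑ n ∈ range N, |f ((z (k + l + n)).1) - f ((z (k + l + n)).2)|) / L) ∂P ≤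
      (1 - (w x₀)⁻¹) ^ k * (c - a) ^ 2 * w x₀ := by
    have hsumi : Integrable (fun z : ℕ → Ω × Ω =>
        ∑ l ∈ range L, ∑ n ∈ range N, |f ((z (k + l + n)).1) - f ((z (k + l + n)).2)|) P :=
      integrable_finsetSum _ fun l _ => integrable_finsetSum _ fun n _ => hDi (k + l + n)
    calc ∫ z, |(∑ l ∈ range L, f ((z (k + l)).2)) / L - m| *
          ((∑ l ∈ range L, ∑ n ∈ range N, |f ((z (k + l + n)).1) - f ((z (k + l + n)).2)|) / L) ∂P
        ≤ ∫ z, (c - a) / L *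
            ∑ l ∈ range L, ∑ n ∈ range N, |f ((z (k + l + n)).1) - f ((z (k + l + n)).2)| ∂P := by
          refine integral_mono hATi (hsumi.const_mul _) fun z => ?_
          dsimp only
          rw [div_mul_eq_mul_div, mul_div_assoc]
          exact mul_le_mul_of_nonneg_right (hAb z) (hTbarnn z)
      _ = (c - a) / L * ∑ l ∈ range L, ∑ n ∈ range N, ∫ z, |f ((z (k + l + n)).1) - f ((z (k + l + n)).2)| ∂P := by
          rw [integral_const_mul, integral_finsetSum _ fun l _ => integrable_finsetSum _ fun n _ => hDi (k + l + n)]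
          congr 1
          exact sum_congr rfl fun l _ => integral_finsetSum _ fun n _ => hDi (k + l + n)
      _ ≤ (c - a) / L * ∑ l ∈ range L, ((1 - (w x₀)⁻¹) ^ k * (c - a) * w x₀) := by
          refine mul_le_mul_of_nonneg_left (sum_le_sum fun l _ => ?_) (div_nonneg hca hLpos.le)
          refine (sum_le_sum fun n _ => crnLag_integral_abs_diff_le hw0 hmax Khat hK μ₀ hf ha hc (k + l + n)).trans ?_
          refine (hgeomN (k + l)).trans ?_
          exact mul_le_mul_of_nonneg_right (mul_le_mul_of_nonneg_right (hpowle l) hca) hWpos.le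
      _ = (1 - (w x₀)⁻¹) ^ k * (c - a) ^ 2 * w x₀ := by
          rw [sum_const, card_range, nsmul_eq_mul]
          field_simp
  -- (E3) the square of the correction: `T̄² ≤ (1/L)Σ_l T_l²`
  have hTl2i : ∀ l, Integrable (fun z : ℕ → Ω × Ω =>
      (∑ n ∈ range N, |f ((z (k + l + n)).1) - f ((z (k + l + n)).2)|) ^ 2) P := fun l =>
    integrable_of_bounded P ((hTm l).pow_const 2) (C := (N * (c - a)) ^ 2) (fun z => by
      rw [abs_pow, abs_of_nonneg (hTnn l z)]; exact pow_le_pow_left₀ (hTnn l z) (hTb l z) 2)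
  have hE3 : ∫ z, ((∑ l ∈ range L, ∑ n ∈ range N, |f ((z (k + l + n)).1) - f ((z (k + l + n)).2)|) / L) ^ 2 ∂P ≤
      (1 - (w x₀)⁻¹) ^ k * (c - a) ^ 2 * (w x₀ * (2 * w x₀ - 1)) := by
    have hsumi : Integrable (fun z : ℕ → Ω × Ω =>
        (∑ l ∈ range L, (∑ n ∈ range N, |f ((z (k + l + n)).1) - f ((z (k + l + n)).2)|) ^ 2) / L) P :=
      (integrable_finsetSum _ fun l _ => hTl2i l).div_const _
    calc ∫ z, ((∑ l ∈ range L, ∑ n ∈ range N, |f ((z (k + l + n)).1) - f ((z (k + l + n)).2)|) / L) ^ 2 ∂P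
        ≤ ∫ z, (∑ l ∈ range L, (∑ n ∈ range N, |f ((z (k + l + n)).1) - f ((z (k + l + n)).2)|) ^ 2) / L ∂P :=
          integral_mono hT2i hsumi fun z => sq_rangeAvg_le_rangeAvg_sq _ L
      _ = (∑ l ∈ range L, ∫ z, (∑ n ∈ range N, |f ((z (k + l + n)).1) - f ((z (k + l + n)).2)|) ^ 2 ∂P) / L := by
          rw [integral_div, integral_finsetSum _ fun l _ => hTl2i l]
      _ ≤ (∑ l ∈ range L, (1 - (w x₀)⁻¹) ^ k * (c - a) ^ 2 * (w x₀ * (2 * w x₀ - 1))) / L := by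
          refine div_le_div_of_nonneg_right (sum_le_sum fun l _ => ?_) hLpos.le
          refine (crnLag_integral_sq_sum_abs_le hw0 hmax Khat hK μ₀ hf ha hc (k + l) N).trans ?_
          have hWW : 0 ≤ w x₀ * (2 * w x₀ - 1) := mul_nonneg hWpos.le (by linarith)
          exact mul_le_mul_of_nonneg_right (mul_le_mul_of_nonneg_right (hpowle l) (sq_nonneg _)) hWW
      _ = (1 - (w x₀)⁻¹) ^ k * (c - a) ^ 2 * (w x₀ * (2 * w x₀ - 1)) := by
          rw [sum_const, card_range, nsmul_eq_mul]
          field_simp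
  calc ∫ z, ((∑ l ∈ range L, (f ((z (k + l)).2) +
          ∑ n ∈ range N, (f ((z (k + l + n)).1) - f ((z (k + l + n)).2)))) / L - m) ^ 2 ∂P
      ≤ ∫ z, (((∑ l ∈ range L, f ((z (k + l)).2)) / L - m) ^ 2 +
          2 * (|(∑ l ∈ range L, f ((z (k + l)).2)) / L - m| *
            ((∑ l ∈ range L, ∑ n ∈ range N, |f ((z (k + l + n)).1) - f ((z (k + l + n)).2)|) / L)) +
          ((∑ l ∈ range L, ∑ n ∈ range N, |f ((z (k + l + n)).1) - f ((z (k + l + n)).2)|) / L) ^ 2) ∂P :=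
        integral_mono hLi h123 hpt
    _ = ∫ z, ((∑ l ∈ range L, f ((z (k + l)).2)) / L - m) ^ 2 ∂P +
          2 * ∫ z, |(∑ l ∈ range L, f ((z (k + l)).2)) / L - m| *
            ((∑ l ∈ range L, ∑ n ∈ range N, |f ((z (k + l + n)).1) - f ((z (k + l + n)).2)|) / L) ∂P +
          ∫ z, ((∑ l ∈ range L, ∑ n ∈ range N, |f ((z (k + l + n)).1) - f ((z (k + l + n)).2)|) / L) ^ 2 ∂P := by
        rw [integral_add h12 hT2i, integral_add hA2i (hATi.const_mul 2), integral_const_mul]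
    _ ≤ ∫ x, ((∑ l ∈ range L, f (x (k + l))) / L - m) ^ 2
          ∂(Kernel.trajMeasure (X := fun _ : ℕ => Ω) (μ₀.map Prod.snd)
            (fun n : ℕ => (indepMH q w).comap (fun h : (i : ↥(Finset.Iic n)) → Ω => h ⟨n, Finset.mem_Iic.2 le_rfl⟩)
              (measurable_pi_apply _))) +
          2 * ((1 - (w x₀)⁻¹) ^ k * (c - a) ^ 2 * w x₀) + (1 - (w x₀)⁻¹) ^ k * (c - a) ^ 2 * (w x₀ * (2 * w x₀ - 1)) := by
        rw [hE1]
        exact add_le_add (add_le_add le_rfl (mul_le_mul_of_nonneg_left hE2 zero_le_two)) hE3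
    _ = _ := by ring

/-- **EXPLICIT FORM**: `E[(H̄ − π f)²] ≤ (2W − 1)·Var_π f/L + r^k·(D² + (c − a)²·W(2W + 1))` from every initial coupling
(GEN-35's any-start window certificate `MSE_{μ₂}(L; k) ≤ (2W − 1)Var_π f/L + r^k D²` for the first term). [ours] -/
theorem crnLagAvg_sq_le_explicit [Fact (Measurable w)] (hw0 : ∀ y, 0 < w y) {x₀ : Ω} (hmax : ∀ y, w y ≤ w x₀)
    [IsProbabilityMeasure (q.withDensity fun y => ENNReal.ofReal (w y))]
    (Khat : Kernel (Ω × Ω) (Ω × Ω)) [IsMarkovKernel Khat]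
    (hK : ∀ z : Ω × Ω, Khat z = (q.prod (volume : Measure unitInterval)).map (fun p : Ω × unitInterval =>
      ((if (p.2 : ℝ) * w z.1 ≤ w p.1 then p.1 else z.1), (if (p.2 : ℝ) * w z.2 ≤ w p.1 then p.1 else z.2))))
    (μ₀ : Measure (Ω × Ω)) [IsProbabilityMeasure μ₀] {f : Ω → ℝ} (hf : Measurable f) {a c : ℝ}
    (ha : ∀ x, a ≤ f x) (hc : ∀ x, f x ≤ c) (k N : ℕ) {L : ℕ} (hL : L ≠ 0) :
    ∫ z, ((∑ l ∈ Finset.range L, (f ((z (k + l)).2) +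
          ∑ n ∈ Finset.range N, (f ((z (k + l + n)).1) - f ((z (k + l + n)).2)))) / L -
          ∫ x, f x ∂(q.withDensity fun y => ENNReal.ofReal (w y))) ^ 2
        ∂(Kernel.trajMeasure (X := fun _ : ℕ => Ω × Ω) μ₀
          (fun n : ℕ => Khat.comap (fun h : (i : ↥(Finset.Iic n)) → Ω × Ω => h ⟨n, Finset.mem_Iic.2 le_rfl⟩)
            (measurable_pi_apply _))) ≤
      (2 * w x₀ - 1) *
          (∫ x, (f x - ∫ z, f z ∂(q.withDensity fun y => ENNReal.ofReal (w y))) ^ 2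
            ∂(q.withDensity fun y => ENNReal.ofReal (w y))) / L +
        (1 - (w x₀)⁻¹) ^ k *
          (max (∫ z, f z ∂(q.withDensity fun y => ENNReal.ofReal (w y)) - a)
              (c - ∫ z, f z ∂(q.withDensity fun y => ENNReal.ofReal (w y))) ^ 2 +
            (c - a) ^ 2 * (w x₀ * (2 * w x₀ + 1))) := by
  haveI : IsProbabilityMeasure (μ₀.map Prod.snd) := Measure.isProbabilityMeasure_map measurable_snd.aemeasurable
  have h1 := crnLagAvg_sq_le hw0 hmax Khat hK μ₀ hf ha hc k N hL
  have h2 := imh_chain_windowMSE_anyStart_le_explicit (q := q) hw0 hmax (μ₀.map Prod.snd) hf ha hc k hL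
  linarith

end Summit.Ventures.LatticeQCDFlow.Exactness

end
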